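import Literature.NumberTheory.GaloisRepresentations.ProfiniteIntersectionCocycleExtension
import Literature.NumberTheory.GaloisRepresentations.LocalBrauerUnramifiedSplitting
import Literature.NumberTheory.GaloisRepresentations.CohomologicalDimensionTsenProofs
import Literature.NumberTheory.GaloisRepresentations.InertiaRootsOfUnity
import Mathlib.FieldTheory.Finite.Basic
import HarnessLib

/-!
# `cd_p(Gal(F̄/F^nr)) ≤ 1` for a non-archimedean local field `F` of characteristic `0`

Topic `NumberTheory/GaloisRepresentations`; namespace `Literature.NumberTheory.GaloisRepresentations`.
Definitions with bodies and theorems only (no named fact; D-0026).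

Let `F` be a non-archimedean local field of characteristic `0`, `F_n ⊆ F̄` its unramified extension
of degree `n` (`unramifiedLevel F n`), `F^nr = ⋃ₙ F_n` the maximal unramified extension and
`N = Gal(F̄/F^nr) = ⋂ₙ Gal(F̄/F_n)` (`galUnr F`; it is written as the intersection along the
increasing tower `T_k = F_1 F_2 ⋯ F_{k+1}`, `unrStage F k`, and **equals the inertia group
`I_F = absInertia F`** of the tree, `galUnr_eq_absInertia` — `⊇` because `I_F` fixes every `F_n`,
`⊆` because every root of unity of order prime to `p` lies in some `F_n`
(`mem_absInertia_iff_smul_rootsOfUnity`); by `mem_absInertia_iff_forall_mem_maxUnramified`,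
`I_F = Gal(F̄/F^nr)` with `F^nr = maxUnramified F`).  We prove

* `subsingleton_two_mu_inf_galUnr` — **`H²(Gal(F̄/E F^nr), μ_p) = 0`** for every finite `E/F`:
  `Gal(F̄/E F^nr) = ⋂ₖ Gal(F̄/E T_k)`, every class of `H²` of the intersection comes from a finite
  stage (`exists_resSub_eq_of_iInf`, `ProfiniteIntersectionCocycleExtension`) and the class of a
  finite stage dies after adjoining a further unramified level (`resSub_unrLevel_two_mu_eq_zero`,
  `LocalBrauerUnramifiedSplitting`: `Br(E')[p]` is split by the unramified extension of degree `p`);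
* `exists_eq_subgroupOf_of_isOpen` — every open subgroup of `N` is `N ∩ Gal(F̄/E)` for a finite `E`;
* `groupCdLE_one_galUnr`, `groupCdLE_one_absInertia` — **`cd_p(N) = cd_p(I_F) ≤ 1` for every
  prime `p`**: by Serre I §3.1 Prop. 11
  (`groupCdLE_one_of_forall_subsingleton_two`) and the reduction to finite modules
  (`subsingleton_of_forall_finite`) it suffices that `H²(N, B) = 0` for finite `p`-primary `B`;
  Sylow descent to an open subgroup acting through a `p`-group (`subsingleton_of_isOpen_of_index_coprime`,
  `subsingleton_two_of_pGroup_quotient`) reduces to trivial `B` of order `p`, which is `μ_p` over the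
  cyclotomic subgroup (index dividing `p - 1`, `exists_galFixing_cyclotomic`), where the first item
  applies.

This is the computation "`cd(G_{K^nr}) ≤ 1` because the Brauer groups of the finite extensions of
`K^nr` vanish" in Serre's proof of `cd_p(G_K) = 2` (*Cohomologie galoisienne* II §4.3 Prop. 12),
done here without Lang's theorem (`K^nr` is `C₁`): the vanishing of `H²(·, μ_p)` along the
unramified tower is read off from the structure of `Br(L/K)` for local fields (Serre,
*Corps locaux* XIII §3).  The conclusion `cd_p(Γ_F) ≤ 2` is drawn in `LocalFieldCdTwo`.

## References
* J.-P. Serre, *Cohomologie galoisienne* / *Galois Cohomology* (1997), II §4.3 Prop. 12, I §3.1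
  Prop. 11, I §3.3 Prop. 14 and Cor. 1, II §3.1 Prop. 5 (proof). [SerreGaloisCohomology1997]
* J.-P. Serre, *Corps locaux* (1968), XIII §3; IV §4. [SerreLocalFields1979]
-/

noncomputable section

open CategoryTheory Function
open Field IsNonarchimedeanLocalField ValuativeRel IntermediateField

universe u

namespace Literature.NumberTheory.GaloisRepresentations

open _root_.TopRep _root_.ContRepresentation _root_.ContinuousCohomology DiscreteGaloisModule
open _root_.Topology _root_.Filter
open LocalWeilDatum GaloisRepresentations.IsNonarchimedeanLocalField

section Local

variable (F : Type u) [Field F] [ValuativeRel F] [TopologicalSpace F] [IsNonarchimedeanLocalField F]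

attribute [local instance] compactSpace_of_isClosed_subgroup isClosed_galFixing'

/-! ### The unramified tower `T_k = F_1 F_2 ⋯ F_{k+1}` and `N = Gal(F̄/F^nr)` -/

/-- **The `k`-th stage `T_k = F_1 F_2 ⋯ F_{k+1}` of the unramified tower** (an increasing cofinal
sequence of finite unramified Galois extensions of `F`). [cite: SerreLocalFields1979, IV §4] -/
def unrStage : ℕ → IntermediateField F (AlgebraicClosure F)
  | 0 => unramifiedLevel F 1
  | k + 1 => unrStage k ⊔ unramifiedLevel F (k + 2)

/-- `T_k ≤ T_{k+1}`. [folklore] -/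
theorem unrStage_le_succ (k : ℕ) : unrStage F k ≤ unrStage F (k + 1) :=
  le_sup_left (b := unramifiedLevel F (k + 2))

/-- The tower is increasing. [folklore] -/
theorem unrStage_mono : Monotone (unrStage F) :=
  monotone_nat_of_le_succ (unrStage_le_succ F)

/-- `F_{k+1} ≤ T_k`. [folklore] -/
theorem unramifiedLevel_succ_le_unrStage (k : ℕ) : unramifiedLevel F (k + 1) ≤ unrStage F k := by
  cases k with
  | zero => exact le_rfl
  | succ k => exact le_sup_right

/-- `F_n ≤ T_k` for `1 ≤ n ≤ k + 1`. [folklore] -/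
theorem unramifiedLevel_le_unrStage {n k : ℕ} (hn : 0 < n) (hnk : n ≤ k + 1) :
    unramifiedLevel F n ≤ unrStage F k := by
  obtain ⟨n', rfl⟩ : ∃ n', n = n' + 1 := ⟨n - 1, by omega⟩
  exact (unramifiedLevel_succ_le_unrStage F n').trans (unrStage_mono F (by omega))

/-- Each stage is finite over `F`. [folklore] -/
instance finiteDimensional_unrStage : ∀ k : ℕ, FiniteDimensional F (unrStage F k)
  | 0 => by
    change FiniteDimensional F (unramifiedLevel F 1)
    exact (unramifiedLevel_finite_abelian_unramified F Nat.one_pos).1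
  | k + 1 => by
    haveI := finiteDimensional_unrStage k
    haveI := (unramifiedLevel_finite_abelian_unramified F (Nat.succ_pos (k + 1))).1
    change FiniteDimensional F (↥(unrStage F k ⊔ unramifiedLevel F (k + 2)))
    exact IntermediateField.finiteDimensional_sup _ _

/-- Each stage is Galois over `F`. [folklore] -/
instance isGalois_unrStage : ∀ k : ℕ, IsGalois F (unrStage F k)
  | 0 => by
    haveI := (unramifiedLevel_finite_abelian_unramified F Nat.one_pos).2.1
    change IsGalois F (unramifiedLevel F 1)
    infer_instance
  | k + 1 => by
    haveI := isGalois_unrStage k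
    haveI := (unramifiedLevel_finite_abelian_unramified F (Nat.succ_pos (k + 1))).1
    haveI := (unramifiedLevel_finite_abelian_unramified F (Nat.succ_pos (k + 1))).2.1
    change IsGalois F (↥(unrStage F k ⊔ unramifiedLevel F (k + 2)))
    exact isGalois_iff.2 ⟨inferInstance, inferInstance⟩

/-- **The inertia group fixes every stage of the unramified tower.** [cite: SerreLocalFields1979, IV §4 Cor. to Prop. 16] -/
theorem absInertia_le_galFixing_unrStage : ∀ k : ℕ, absInertia F ≤ galFixing F (unrStage F k)
  | 0 => fun σ hσ => (mem_galFixing_iff F).2 fun x hx =>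
      (unramifiedLevel_finite_abelian_unramified F Nat.one_pos).2.2 σ hσ ⟨x, hx⟩
  | k + 1 => by
    change absInertia F ≤ galFixing F (unrStage F k ⊔ unramifiedLevel F (k + 2))
    rw [galFixing_sup]
    exact le_inf (absInertia_le_galFixing_unrStage k) fun σ hσ => (mem_galFixing_iff F).2 fun x hx =>
      (unramifiedLevel_finite_abelian_unramified F (Nat.succ_pos (k + 1))).2.2 σ hσ ⟨x, hx⟩

/-- **`N = ⋂ₖ Gal(F̄/T_k)`**, the subgroup fixing every stage of the unramified tower, i.e. fixing
`⋃ₙ F_n`; it is the inertia group `I_F = absInertia F = Gal(F̄/F^nr)` (`galUnr_eq_absInertia`, with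
`F^nr = maxUnramified F` by `mem_absInertia_iff_forall_mem_maxUnramified`).  The intersection form is
the one used in the cohomological proofs below.
[cite: SerreLocalFields1979, IV §4; SerreGaloisCohomology1997, II §4.3] -/
def galUnr : Subgroup (absoluteGaloisGroup F) := ⨅ k, galFixing F (unrStage F k)

/-- `N ≤ Gal(F̄/T_k)`. [folklore] -/
theorem galUnr_le (k : ℕ) : galUnr F ≤ galFixing F (unrStage F k) := iInf_le _ k

/-- `N ≤ Gal(F̄/F_n)` for `n ≥ 1`. [folklore] -/
theorem galUnr_le_galFixing_unramifiedLevel {n : ℕ} (hn : 0 < n) :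
    galUnr F ≤ galFixing F (unramifiedLevel F n) :=
  (galUnr_le F (n - 1)).trans (galFixing_antitone F (unramifiedLevel_le_unrStage F hn (by omega)))

/-- **The inertia group is contained in `N`.** [cite: SerreLocalFields1979, IV §4] -/
theorem absInertia_le_galUnr : absInertia F ≤ galUnr F :=
  le_iInf (absInertia_le_galFixing_unrStage F)

/-- **`N` is contained in the inertia group**: an element fixing every `F_n = F(ζ_{q^n-1})` fixes
every root of unity `ζ` of order `N` prime to `p` (`N ∣ q^{φ(N)} - 1`, so `ζ` is a power of
`ζ_{q^{φ(N)}-1}`), hence lies in `I_F` (`mem_absInertia_iff_smul_rootsOfUnity`).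
[cite: SerreLocalFields1979, IV §4 Cor. 2 to Prop. 16] -/
theorem galUnr_le_absInertia : galUnr F ≤ absInertia F := by
  intro σ hσ
  rw [mem_absInertia_iff_smul_rootsOfUnity]
  intro N hN ζ hζ
  obtain ⟨hN0, hpN⟩ := pos_and_not_ringChar_dvd_of_isUnit_natCast hN
  obtain ⟨f, -, hq⟩ := residueFieldCard_eq_pow_ringChar F
  have hcop : Nat.Coprime (residueFieldCard F) N := by
    rw [hq]
    exact Nat.Coprime.pow_left _ ((Nat.Prime.coprime_iff_not_dvd (ringChar_residueField_prime (F := F))).2 hpN)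
  set n : ℕ := Nat.totient N with hn
  have hnpos : 0 < n := Nat.totient_pos.2 hN0
  -- `N ∣ q ^ n - 1`, so `ζ ^ (q ^ n - 1) = 1`
  have hmod : residueFieldCard F ^ n ≡ 1 [MOD N] := Nat.ModEq.pow_totient hcop
  have hdvd : N ∣ residueFieldCard F ^ n - 1 :=
    (Nat.modEq_iff_dvd' (Nat.one_le_pow _ _ (Nat.zero_lt_of_lt (one_lt_residueFieldCard F)))).1 hmod.symm
  obtain ⟨c, hc⟩ := hdvd
  have hζ' : ζ ^ (residueFieldCard F ^ n - 1) = 1 := by rw [hc, pow_mul, hζ, one_pow]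
  -- `ζ` is a power of the primitive root generating `F_n`
  haveI : NeZero (residueFieldCard F ^ n - 1) := ⟨residueFieldCard_pow_sub_one_ne_zero F n hnpos⟩
  obtain ⟨i, -, hi⟩ := (isPrimitiveRoot_rootOfUnramifiedLevel F hnpos).eq_pow_of_pow_eq_one hζ'
  have hmem : ζ ∈ unramifiedLevel F n := by
    rw [← hi]
    exact pow_mem (IntermediateField.mem_adjoin_simple_self F _) i
  exact (mem_galFixing_iff F).1 (galUnr_le_galFixing_unramifiedLevel F hnpos hσ) ζ hmem

/-- **`N = ⋂ₖ Gal(F̄/T_k)` is the inertia group `I_F = Gal(F̄/F^nr)`** (`absInertia F`; by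
`mem_absInertia_iff_forall_mem_maxUnramified` this is also `Gal(F̄/maxUnramified F)`).
[cite: SerreLocalFields1979, IV §4 Cor. 2 to Prop. 16] -/
theorem galUnr_eq_absInertia : galUnr F = absInertia F :=
  le_antisymm (galUnr_le_absInertia F) (absInertia_le_galUnr F)

/-- `N` is normal in `Γ_F`. [folklore] -/
instance normal_galUnr : (galUnr F).Normal := by
  haveI : ∀ k, (galFixing F (unrStage F k)).Normal := fun k => normal_galFixing _
  exact Subgroup.normal_iInf_normal fun k => inferInstance

/-- `N` is closed in `Γ_F`. [folklore] -/
theorem isClosed_galUnr : IsClosed (galUnr F : Set (absoluteGaloisGroup F)) := by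
  change IsClosed (((⨅ k, galFixing F (unrStage F k) : Subgroup (absoluteGaloisGroup F)) :
    Set (absoluteGaloisGroup F)))
  rw [Subgroup.coe_iInf]
  exact isClosed_iInter fun k => isClosed_galFixing F _

/-- `N` is closed (instance form). [folklore] -/
instance isClosed_galUnr' : IsClosed ((galUnr F : Subgroup (absoluteGaloisGroup F)) : Set (absoluteGaloisGroup F)) :=
  isClosed_galUnr F

/-! ### `H²(Gal(F̄/E F^nr), μ_p) = 0` -/

/-- The subgroups `Gal(F̄/E T_k)` decrease with `k`. [folklore] -/
theorem antitone_galFixing_sup_unrStage (E : IntermediateField F (AlgebraicClosure F)) :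
    Antitone fun k => galFixing F (E ⊔ unrStage F k) :=
  fun _ _ h => galFixing_antitone F (sup_le_sup_left (unrStage_mono F h) E)

/-- `⋂ₖ Gal(F̄/E T_k) = Gal(F̄/E) ∩ N`. [folklore] -/
theorem iInf_galFixing_sup_unrStage (E : IntermediateField F (AlgebraicClosure F)) :
    (⨅ k, galFixing F (E ⊔ unrStage F k)) = galFixing F E ⊓ galUnr F := by
  simp_rw [galFixing_sup]
  rw [galUnr, iInf_inf_eq, iInf_const]

variable [CharZero F]

/-- **`H²(⋂ₖ Gal(F̄/E T_k), μ_n) = 0`** for `E/F` finite and `n ≥ 1`: every class comes from a finite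
stage `Gal(F̄/E T_k)` (`exists_resSub_eq_of_iInf`), and a class of `H²(Gal(F̄/E'), μ_n)`, `E' = E T_k`,
dies on `Gal(F̄/E' F_{n f_{E'}}) ⊇ Gal(F̄/E T_{k'})` for `k'` large (`resSub_unrLevel_two_mu_eq_zero`).
[cite: SerreLocalFields1979, XIII §3 Cor. 3] [cite: SerreGaloisCohomology1997, I §2.2 Prop. 8] -/
theorem subsingleton_two_mu_iInf (E : IntermediateField F (AlgebraicClosure F)) [FiniteDimensional F E]
    {n : ℕ} (hn : 0 < n) :
    Subsingleton (continuousCohomology 2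
      ((mu F n).restrict (subgroupIncl (⨅ k, galFixing F (E ⊔ unrStage F k)))).toTopRep) := by
  classical
  haveI : NeZero n := ⟨hn.ne'⟩
  haveI : NeZero ((n : ℕ) : F) := NeZero.charZero
  have hcmu : Nat.card (MuCarrier F n) = n := by
    change Nat.card (rootsOfUnity n (AlgebraicClosure F)) = n
    exact HasEnoughRootsOfUnity.natCard_rootsOfUnity _ n
  haveI : Finite (MuCarrier F n) := Nat.finite_of_card_ne_zero (by rw [hcmu]; exact hn.ne')
  refine subsingleton_two_iInf_of_forall_exists_resSub_eq_zero (mu F n) _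
    (antitone_galFixing_sup_unrStage F E) (fun k => isClosed_galFixing F _) fun k y => ?_
  -- the class `y` of the stage `E' = E T_k` dies on `Gal(F̄/E' F_m)`, `m = n f_{E'}`
  haveI : FiniteDimensional F (E ⊔ unrStage F k : IntermediateField F (AlgebraicClosure F)) :=
    IntermediateField.finiteDimensional_sup _ _
  set m : ℕ := n * fDeg F (E ⊔ unrStage F k) with hmdef
  have hm : 0 < m := Nat.mul_pos hn (fDeg_pos F _)
  have hkill := resSub_unrLevel_two_mu_eq_zero F (E ⊔ unrStage F k) hn y
  -- `E' F_m ≤ E T_{k'}` for `k' = max k (m - 1)`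
  refine ⟨max k (m - 1), le_max_left _ _, ?_⟩
  have hle : unrLevel F (E ⊔ unrStage F k) m ≤ E ⊔ unrStage F (max k (m - 1)) := by
    refine sup_le (sup_le_sup_left (unrStage_mono F (le_max_left _ _)) E) ?_
    exact (unramifiedLevel_le_unrStage F hm (by omega)).trans le_sup_right
  have hsub : galFixing F (E ⊔ unrStage F (max k (m - 1))) ≤ galFixing F (unrLevel F (E ⊔ unrStage F k) m) :=
    galFixing_antitone F hle
  rw [← resSub_resSub (mu F n) hsub (galFixing_antitone F (le_unrLevel F (E ⊔ unrStage F k) m)) 2 y,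
    hkill, map_zero]

/-- **`H²(Gal(F̄/E) ∩ N, μ_n) = 0`**, `N = Gal(F̄/F^nr)`, for `E/F` finite and `n ≥ 1`.
[cite: SerreLocalFields1979, XIII §3 Cor. 3] [cite: SerreGaloisCohomology1997, II §4.3 Prop. 12 (proof)] -/
theorem subsingleton_two_mu_inf_galUnr (E : IntermediateField F (AlgebraicClosure F))
    [FiniteDimensional F E] {n : ℕ} (hn : 0 < n) :
    Subsingleton (continuousCohomology 2
      ((mu F n).restrict (subgroupIncl (galFixing F E ⊓ galUnr F))).toTopRep) := by
  rw [← iInf_galFixing_sup_unrStage]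
  exact subsingleton_two_mu_iInf F E hn

/-! ### Open subgroups of `N` -/

omit [CharZero F] in
/-- **Every open subgroup of `N = Gal(F̄/F^nr)` is `N ∩ Gal(F̄/E)` for a finite `E/F`** (an open
subgroup `H'` of `N` contains `N ∩ Gal(F̄/L₀)` for a finite Galois `L₀`; the open subgroup
`H' · Gal(F̄/L₀)` of `Γ_F` is `Gal(F̄/E)` for a finite `E`, and meets `N` in `H'` by the modular law).
[folklore] -/
theorem exists_eq_subgroupOf_of_isOpen (H' : Subgroup (galUnr F)) (hH' : IsOpen (H' : Set (galUnr F))) :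
    ∃ E : IntermediateField F (AlgebraicClosure F), FiniteDimensional F E ∧
      H'.map (galUnr F).subtype = galFixing F E ⊓ galUnr F := by
  classical
  -- `N ∩ Gal(F̄/L₀) ≤ H'` for a finite Galois `L₀`
  obtain ⟨V, hV, hVH⟩ := (mem_nhds_subtype _ (1 : galUnr F) (H' : Set (galUnr F))).1
    (hH'.mem_nhds H'.one_mem)
  obtain ⟨L₀, hfin, hgal, hL₀⟩ := exists_finiteDimensional_isGalois_galFixing_subset (k := F) hV
  haveI := hfin
  haveI := hgal
  haveI : (galFixing F L₀).Normal := normal_galFixing L₀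
  set H'' : Subgroup (absoluteGaloisGroup F) := H'.map (galUnr F).subtype with hH''def
  have hH''N : H'' ≤ galUnr F := Subgroup.map_subtype_le H'
  -- the open subgroup `T = H'' Gal(F̄/L₀)` of `Γ_F` is `Gal(F̄/E)`
  set T : Subgroup (absoluteGaloisGroup F) := H'' ⊔ galFixing F L₀ with hTdef
  have hkerT : (resGal L₀).ker ≤ T := by rw [ker_resGal]; exact le_sup_right
  set E : IntermediateField F (AlgebraicClosure F) := lift (fixedField (T.map (resGal L₀))) with hEdef
  have hTE : galFixing F E = T := by
    rw [hEdef, galFixing_lift_fixedField, Subgroup.comap_map_eq_self hkerT]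
  haveI : FiniteDimensional F E := (liftAlgEquiv (fixedField (T.map (resGal L₀)))).toLinearEquiv.finiteDimensional
  refine ⟨E, inferInstance, ?_⟩
  rw [hTE]
  apply le_antisymm
  · exact le_inf le_sup_left hH''N
  · intro x hx
    obtain ⟨hxT, hxN⟩ := Subgroup.mem_inf.1 hx
    have hxT' : (x : absoluteGaloisGroup F) ∈ ((T : Subgroup (absoluteGaloisGroup F)) : Set (absoluteGaloisGroup F)) := hxT
    rw [hTdef, Subgroup.mul_normal] at hxT'
    obtain ⟨h, hh, g, hg, rfl⟩ := Set.mem_mul.1 hxT'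
    -- `g = h⁻¹ x ∈ N ∩ Gal(F̄/L₀) ≤ H''`
    have hgN : g ∈ galUnr F := by
      have := (galUnr F).mul_mem ((galUnr F).inv_mem (hH''N hh)) hxN
      rwa [inv_mul_cancel_left] at this
    have hgH' : (⟨g, hgN⟩ : galUnr F) ∈ H' := hVH (show ((⟨g, hgN⟩ : galUnr F) : absoluteGaloisGroup F) ∈ V from hL₀ hg)
    have hgH'' : g ∈ H'' := ⟨⟨g, hgN⟩, hgH', rfl⟩
    exact H''.mul_mem hh hgH''

/-- **`H²(H', μ_n) = 0` for every open subgroup `H'` of `N = Gal(F̄/F^nr)`** (`n ≥ 1`).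
[cite: SerreGaloisCohomology1997, II §4.3 Prop. 12 (proof)] -/
theorem subsingleton_two_mu_of_isOpen {n : ℕ} (hn : 0 < n) (H' : Subgroup (galUnr F))
    (hH' : IsOpen (H' : Set (galUnr F))) :
    Subsingleton (continuousCohomology 2
      (((mu F n).restrict (subgroupIncl (galUnr F))).restrict (subgroupIncl H')).toTopRep) := by
  obtain ⟨E, hfin, hE⟩ := exists_eq_subgroupOf_of_isOpen F H' hH'
  haveI := hfin
  have hle : galFixing F E ⊓ galUnr F ≤ galUnr F := inf_le_right
  have hH'eq : H' = (galFixing F E ⊓ galUnr F).subgroupOf (galUnr F) := by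
    rw [← hE]
    exact (Subgroup.comap_map_eq_self_of_injective (galUnr F).subtype_injective H').symm
  have s1 := subsingleton_two_mu_inf_galUnr F E hn
  rw [hH'eq]
  exact (subsingleton_iff_of_continuousMulEquiv (Subgroup.subgroupOfContinuousMulEquivOfLe hle)
    ((mu F n).restrict (subgroupIncl (galFixing F E ⊓ galUnr F)))
    (((mu F n).restrict (subgroupIncl (galUnr F))).restrict
      (subgroupIncl ((galFixing F E ⊓ galUnr F).subgroupOf (galUnr F)))) (fun _ _ => rfl) 2).1 s1

/-! ### `cd_p(N) ≤ 1` -/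

/-- **`H²(H, W) = 0` for every open `H ≤ N` and every trivial `H`-module `W` of prime order `p`**:
over `H' = H ∩ Gal(F̄/F(ζ_p))` (index dividing `p - 1`) `W ≅ μ_p`, and `H²(H', μ_p) = 0`
(`subsingleton_two_mu_of_isOpen`). [cite: SerreGaloisCohomology1997, II §3.1 Prop. 5 (proof), II §4.3 Prop. 12] -/
theorem subsingleton_two_of_trivial_card_prime_galUnr {p : ℕ} [hp : Fact p.Prime]
    (H : Subgroup (galUnr F)) (hH : IsOpen (H : Set (galUnr F)))
    (W : Type u) [AddCommGroup W] [TopologicalSpace W] [DiscreteTopology W] [Finite W]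
    (σ : ContinuousRep H ℤ W) (htriv : ∀ (g : H) (w : W), σ g w = w) (hcard : Nat.card W = p) :
    Subsingleton (continuousCohomology 2 σ.toTopRep) := by
  classical
  haveI := absoluteGaloisGroup_compactSpace F
  haveI : IsClosed (H : Set (galUnr F)) := Subgroup.isClosed_of_isOpen H hH
  haveI : NeZero ((p : ℕ) : F) := NeZero.charZero
  haveI : NeZero p := ⟨hp.out.ne_zero⟩
  haveI := AlgebraicClosure.hasEnoughRootsOfUnity F p
  obtain ⟨S₀, hS₀n, hS₀o, hS₀c, hS₀fix⟩ := exists_galFixing_cyclotomic (k := F) (p := p)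
  haveI := hS₀n
  -- the cyclotomic subgroup pulled back to `N`
  let S₀N : Subgroup (galUnr F) := S₀.comap (galUnr F).subtype
  haveI : S₀N.Normal := Subgroup.Normal.comap inferInstance _
  have hS₀No : IsOpen (S₀N : Set (galUnr F)) := hS₀o.preimage continuous_subtype_val
  have hS₀Nc : S₀N.index.Coprime p := by
    have hdvd : S₀N.index ∣ S₀.index := by
      rw [Subgroup.index_comap, Subgroup.range_subtype]
      exact Subgroup.relIndex_dvd_index_of_normal S₀ (galUnr F)
    exact Nat.Coprime.coprime_dvd_left hdvd hS₀c
  let H' : Subgroup (galUnr F) := S₀N ⊓ H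
  have hH'o : IsOpen (H' : Set (galUnr F)) := by
    change IsOpen ((S₀N : Set (galUnr F)) ∩ H)
    exact hS₀No.inter hH
  have hle : H' ≤ H := inf_le_right
  -- `H²(H', μ_p) = 0`
  have s1 := subsingleton_two_mu_of_isOpen F hp.out.pos H' hH'o
  -- `μ_p ≅ W` over `H'` (both trivial of order `p`)
  let σ' : ContinuousRep H' ℤ W := σ.restrict (inclCMH hle)
  have hmu : ∀ (g : H') (v : MuCarrier F p),
      ((mu F p).restrict (subgroupIncl (galUnr F))).restrict (subgroupIncl H') g v = v := by
    intro g v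
    apply MuCarrier.toAdditive.injective
    rw [ContinuousRep.restrict_apply, subgroupIncl_apply, ContinuousRep.restrict_apply, subgroupIncl_apply,
      mu_apply_apply]
    apply congrArg Additive.ofMul
    apply Subtype.ext
    rw [absoluteGaloisGroup.coe_smul_rootsOfUnity]
    exact hS₀fix _ g.2.1 _
  have hcmu : Nat.card (MuCarrier F p) = p := by
    change Nat.card (rootsOfUnity p (AlgebraicClosure F)) = p
    exact HasEnoughRootsOfUnity.natCard_rootsOfUnity _ p
  haveI : Finite (MuCarrier F p) := Nat.finite_of_card_ne_zero (by rw [hcmu]; exact hp.out.ne_zero)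
  have s2 : Subsingleton (continuousCohomology 2 σ'.toTopRep) :=
    subsingleton_of_trivial_of_card_eq (((mu F p).restrict (subgroupIncl (galUnr F))).restrict (subgroupIncl H'))
      σ' hmu (fun g w => htriv _ w) hcmu hcard 2 s1
  -- transport to `H' ∩ H ≤ H` and up to `H` (index prime to `p`)
  have s3 : Subsingleton (continuousCohomology 2 (σ.restrict (subgroupIncl (H'.subgroupOf H))).toTopRep) :=
    (subsingleton_iff_of_continuousMulEquiv (Subgroup.subgroupOfContinuousMulEquivOfLe hle) σ'
      (σ.restrict (subgroupIncl (H'.subgroupOf H))) (fun _ _ => rfl) 2).1 s2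
  have hM : IsPrimaryTorsion p W := fun w => ⟨1, by
    rw [pow_one]
    exact addOrderOf_dvd_iff_nsmul_eq_zero.1 (hcard ▸ addOrderOf_dvd_natCard w)⟩
  have hSo : IsOpen ((H'.subgroupOf H : Subgroup H) : Set H) := by
    change IsOpen ((Subtype.val : H → galUnr F) ⁻¹' (H' : Set (galUnr F)))
    exact hH'o.preimage continuous_subtype_val
  have hcop : (H'.subgroupOf H).index.Coprime p := by
    change ((S₀N ⊓ H).relIndex H).Coprime p
    rw [Subgroup.inf_relIndex_right]
    exact Nat.Coprime.coprime_dvd_left (Subgroup.relIndex_dvd_index_of_normal S₀N H) hS₀Nc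
  exact subsingleton_of_isOpen_of_index_coprime σ hM hSo hcop 1 s3

/-- **`H²(N, B) = 0` for every finite `p`-primary discrete `N`-module `B`**, `N = Gal(F̄/F^nr)`:
`B` is trivial on an open normal `N₀ ≤ N`; with a Sylow `p`-subgroup `P` of `N/N₀` and its preimage
`H` (open, index prime to `p`) it suffices to treat `H` (`subsingleton_of_isOpen_of_index_coprime`),
which acts through the `p`-group `P`; dévissage (`subsingleton_two_of_pGroup_quotient`) reduces to
`subsingleton_two_of_trivial_card_prime_galUnr`.
[cite: SerreGaloisCohomology1997, II §4.3 Prop. 12, I §3.3 Cor. 1, II §3.1 Prop. 5 (proof)] -/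
theorem subsingleton_two_galUnr_of_finite {p : ℕ} [hp : Fact p.Prime]
    (B : Type u) [AddCommGroup B] [TopologicalSpace B] [DiscreteTopology B] [Finite B]
    (τ : ContinuousRep (galUnr F) ℤ B) (hB : IsPrimaryTorsion p B) :
    Subsingleton (continuousCohomology 2 τ.toTopRep) := by
  classical
  haveI := absoluteGaloisGroup_compactSpace F
  -- the kernel is open: an open normal subgroup `N₀` acting trivially
  have hU : (⋂ b : B, {σ : galUnr F | τ σ b = b}) ∈ 𝓝 (1 : galUnr F) :=
    (Filter.iInter_mem).2 fun b => τ.setOf_apply_eq_mem_nhds_one b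
  have h1 : (1 : galUnr F) ∈ interior (⋂ b : B, {σ : galUnr F | τ σ b = b}) :=
    mem_interior_iff_mem_nhds.2 hU
  obtain ⟨N₀, hN₀⟩ := ProfiniteGrp.exist_openNormalSubgroup_sub_open_nhds_of_one isOpen_interior h1
  have hN₀' : ∀ g ∈ (N₀ : Subgroup (galUnr F)), ∀ b : B, τ g b = b := fun g hg b =>
    Set.mem_iInter.1 (interior_subset (hN₀ hg)) b
  -- Sylow `p`-subgroup of the finite quotient and its preimage `H`
  haveI : Finite (galUnr F ⧸ (N₀ : Subgroup (galUnr F))) :=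
    Subgroup.quotient_finite_of_isOpen _ N₀.isOpen
  obtain ⟨P⟩ := (Sylow.nonempty : Nonempty (Sylow p (galUnr F ⧸ (N₀ : Subgroup (galUnr F)))))
  set H : Subgroup (galUnr F) := (P : Subgroup _).comap (QuotientGroup.mk' (N₀ : Subgroup (galUnr F))) with hHdef
  have hN₀H : (N₀ : Subgroup (galUnr F)) ≤ H := by
    intro g hg
    rw [hHdef, Subgroup.mem_comap, QuotientGroup.mk'_apply, (QuotientGroup.eq_one_iff g).2 hg]
    exact one_mem _
  have hHopen : IsOpen (H : Set (galUnr F)) := Subgroup.isOpen_mono hN₀H N₀.isOpen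
  haveI : IsClosed (H : Set (galUnr F)) := Subgroup.isClosed_of_isOpen H hHopen
  have hHidx : H.index.Coprime p := by
    rw [hHdef, Subgroup.index_comap_of_surjective _ (QuotientGroup.mk'_surjective _)]
    exact ((Nat.Prime.coprime_iff_not_dvd hp.out).2 P.not_dvd_index).symm
  -- `H` acts through `P`
  let φ : H →* (P : Subgroup (galUnr F ⧸ (N₀ : Subgroup (galUnr F)))) :=
    ((QuotientGroup.mk' (N₀ : Subgroup (galUnr F))).comp H.subtype).codRestrict _ fun h =>
      Subgroup.mem_comap.1 h.2
  haveI : Finite (H ⧸ φ.ker) :=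
    Finite.of_injective (QuotientGroup.kerLift φ) (QuotientGroup.kerLift_injective φ)
  have hQ : IsPGroup p (H ⧸ φ.ker) :=
    P.isPGroup'.of_injective (QuotientGroup.kerLift φ) (QuotientGroup.kerLift_injective φ)
  have hker : ∀ g ∈ φ.ker, ∀ b : B, (τ.restrict (subgroupIncl H)) g b = b := by
    intro g hg b
    rw [MonoidHom.mem_ker] at hg
    have h1 : QuotientGroup.mk' (N₀ : Subgroup (galUnr F)) (g : galUnr F) = 1 :=
      congrArg (fun x : (P : Subgroup (galUnr F ⧸ (N₀ : Subgroup (galUnr F)))) =>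
        (x : galUnr F ⧸ (N₀ : Subgroup (galUnr F)))) hg
    have h2 : (g : galUnr F) ∈ (N₀ : Subgroup (galUnr F)) := by
      rwa [QuotientGroup.mk'_apply, QuotientGroup.eq_one_iff] at h1
    exact hN₀' _ h2 b
  refine subsingleton_of_isOpen_of_index_coprime τ hB hHopen hHidx 1 ?_
  exact subsingleton_two_of_pGroup_quotient φ.ker hQ
    (fun W _ _ _ _ σ hσ hW => subsingleton_two_of_trivial_card_prime_galUnr F H hHopen W σ hσ hW)
    B (τ.restrict (subgroupIncl H)) hB hker

/-- **`cd_p(Gal(F̄/F^nr)) ≤ 1` for every prime `p`** (`F` non-archimedean local of characteristic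
`0`): Serre I §3.1 Prop. 11 (`groupCdLE_one_of_forall_subsingleton_two`), the reduction to finite
coefficients (`subsingleton_of_forall_finite`) and `subsingleton_two_galUnr_of_finite`.
[cite: SerreGaloisCohomology1997, II §4.3 Prop. 12 (proof: `cd(G_{K^nr}) ≤ 1`)] -/
theorem groupCdLE_one_galUnr (p : ℕ) [hp : Fact p.Prime] : GroupCdLE (galUnr F) p 1 := by
  haveI := absoluteGaloisGroup_compactSpace F
  exact groupCdLE_one_of_forall_subsingleton_two fun M _ _ _ ρ hM =>
    subsingleton_of_forall_finite ρ hp.out.ne_zero 1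
      (fun B _ _ _ _ τ hB => subsingleton_two_galUnr_of_finite F B τ hB) hM

/-- **`cd_p(I_F) ≤ 1` for every prime `p`**: the inertia group `I_F = Gal(F̄/F^nr) = absInertia F` of a
non-archimedean local field of characteristic `0` has `p`-cohomological dimension `≤ 1`
(`groupCdLE_one_galUnr` transported along `galUnr_eq_absInertia`).
[cite: SerreGaloisCohomology1997, II §4.3 Prop. 12 (proof: `cd(G_{K^nr}) ≤ 1`)] -/
theorem groupCdLE_one_absInertia (p : ℕ) [Fact p.Prime] : GroupCdLE (absInertia F) p 1 :=
  galUnr_eq_absInertia F ▸ groupCdLE_one_galUnr F p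

end Local

end Literature.NumberTheory.GaloisRepresentations

end
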